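import Literature.AlgebraicGeometry.ModuliOfAbelianVarieties.SiegelHeckeLink
import HarnessLib

/-!
# The Hecke link WITH ITS DEGREE: `HeckeLinkedDeg 𝓜 𝓜′ r′ y x ν` — ★ `HeckeLinked` remembering the similitude factor `ν` of the
# lattice map ([Milne 2005] §5 Def. 5.14, §6 Thm. 6.11; [Deligne 1971] 4.11–4.12)

Topic `AlgebraicGeometry/ModuliOfAbelianVarieties`; namespace `Literature.AlgebraicGeometry.ModuliOfAbelianVarieties`.
DEFINITION ONLY; no theorem, no named fact, no instance, no notation, no `sorry` (the forgetful map `HeckeLinkedDeg … ν → HeckeLinked …`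
is the one-liner `fun ⟨hδ, hδ', θ, hθo, γ, hθ, r, hr, hδδ, hQA, _, hcut⟩ => ⟨hδ, hδ', θ, hθo, γ, hθ, r, hr, hδδ, hQA, hcut⟩`, proved in the
Summits helper `Theorems/EquidimHeckeQuotientMapOfLinkedDeg` to keep this file statement-only).

★ `HeckeLinked 𝓜 𝓜′ r′ y x` (★ `SiegelHeckeLink`) hides the lattice map `γ` behind `∃` and, with it, its similitude factor
`ν` (`ᵗγ E_δ γ = ν E_{δ′}`, (QA3) of ★ `QuotientAdapted` only says `∃ ν : ℚ`).  The algebraic isogeny-quotient construction on the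
other side of the socket lives at the level `N′ = N·ν` — the DEGREE of the link is part of the datum ([Milne 2005] §5: the Hecke
operator `T(g)` changes the level by `g`; for `g = γ` of multiplier `ν` the quotient has degree `ν^g`).  `HeckeLinkedDeg … ν`
is ★ `HeckeLinked`'s text VERBATIM with ONE extra conjunct recording `ᵗγ E_δ γ = ν • E_{δ′}` for the GIVEN natural number `ν`.

* `HeckeLinkedDeg 𝓜 𝓜′ r′ y x ν` — the predicate.

## References
* [Milne2005ShimuraVarieties] J. S. Milne, *Introduction to Shimura varieties* (2005), §5 p. 58 (Def. 5.14), §6 Thm. 6.11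
  pp. 74–75.
* [Deligne1971TravauxShimura] P. Deligne, *Travaux de Shimura*, Sém. Bourbaki 389 (1971), 4.11–4.12 pp. 148–149.
HC_CM is proved only modulo the 7 printed citations until rung 0 closes; this file asserts nothing.
-/

noncomputable section

open CategoryTheory AlgebraicGeometry Matrix
open Literature.AlgebraicGeometry.Motives (SchemeOver ComplexPoints AlgPoints specOver)
open Literature.AlgebraicGeometry.AbelianSchemes (PolarizedAbelianSchemeWithLevel)
open Literature.NumberTheory.Automorphic (siegelUpperHalfSpace)
open Literature.NumberTheory.Adeles (latticeOfGL)

namespace Literature.AlgebraicGeometry.ModuliOfAbelianVarieties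

open SiegelModuli

/-- **`HeckeLinkedDeg 𝓜 𝓜′ r′ y x ν` — the Hecke link of degree `ν`**: the point `y` of `𝓜′_ℂ` READ AT `r′` is linked to the
point `x` of `𝓜_ℂ` by an open self-map `θ` of `𝔥_g`, a rational lattice map `γ` with `J(θ Z) = γ_ℝ J(Z) γ_ℝ⁻¹`, a principal target
representative `r ∈ K_δ(1)` with `δ′ = δ`, ★ `QuotientAdapted δ δ′ N N′ r r′ γ`, THE SIMILITUDE FACTOR `ν` (`ᵗγ E_δ γ = ν • E_{δ′}`,
the one extra conjunct over ★ `HeckeLinked`), and the analytic cut «every `(Z, r′)`-admissible triple of class `y` has a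
`(θ Z, r)`-admissible partner of class `x`». [cite: Milne2005ShimuraVarieties, §5 p. 58 (Def. 5.14) and §6 Thm. 6.11 p. 74 and p. 75]
[cite: Deligne1971TravauxShimura, 4.11–4.12 pp. 148–149] -/
def HeckeLinkedDeg {g N N' : ℕ} {δ δ' : Fin g → ℕ} (𝓜 : SiegelFineModuliScheme g N δ)
    (𝓜' : SiegelFineModuliScheme g N' δ') (r' : gspFinAdelic δ')
    (y : ComplexPoints ((Motives.baseChange ℚ ℂ).obj 𝓜'.M)) (x : ComplexPoints ((Motives.baseChange ℚ ℂ).obj 𝓜.M))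
    (ν : ℕ) : Prop :=
  haveI : IsLocallyNoetherian (specOver ℚ ℂ).left := inferInstanceAs (IsLocallyNoetherian (Spec (CommRingCat.of ℂ)))
  ∃ (hδ : IsPolarizationType δ) (hδ' : IsPolarizationType δ')
    (θ : siegelUpperHalfSpace g → siegelUpperHalfSpace g) (_ : IsOpenMap θ)
    (γ : GL (Fin g ⊕ Fin g) ℚ)
    (_ : ∀ Z : siegelUpperHalfSpace g,
      jOfSiegel δ ((θ Z : siegelUpperHalfSpace g) : Matrix (Fin g) (Fin g) ℂ) =
        conjJ (Matrix.GeneralLinearGroup.map (algebraMap ℚ ℝ) γ) (jOfSiegel δ' ((Z : siegelUpperHalfSpace g) : Matrix (Fin g) (Fin g) ℂ)))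
    (r : gspFinAdelic δ) (_ : r ∈ principalLevelSubgroup δ 1),
    δ' = δ ∧ QuotientAdapted δ δ' N N' r r' γ ∧
    (γ : Matrix (Fin g ⊕ Fin g) (Fin g ⊕ Fin g) ℚ)ᵀ * typeFormOver δ ℚ * (γ : Matrix (Fin g ⊕ Fin g) (Fin g ⊕ Fin g) ℚ) =
      (ν : ℚ) • typeFormOver δ' ℚ ∧
    ∀ (Z : siegelUpperHalfSpace g) (P' : PolarizedAbelianSchemeWithLevel g N' δ' (specOver ℚ ℂ).left),
      IsAdmissibleAt hδ' r' Z.1 Z.2 P' →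
      AlgPoints.baseChangeEquiv (algebraMap ℚ ℂ) 𝓜'.M (𝓜'.classifyingMap (specOver ℚ ℂ) P') = y →
      ∃ P : PolarizedAbelianSchemeWithLevel g N δ (specOver ℚ ℂ).left,
        IsAdmissibleAt hδ r (θ Z).1 (θ Z).2 P ∧
        AlgPoints.baseChangeEquiv (algebraMap ℚ ℂ) 𝓜.M (𝓜.classifyingMap (specOver ℚ ℂ) P) = x

end Literature.AlgebraicGeometry.ModuliOfAbelianVarieties

end
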